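import Summits.SmoothPoincare4.SmoothPoincare4.Theses.ConvexBisection
import Summits.SmoothPoincare4.SmoothPoincare4.Theorems.AcyclicBisectionExists.Negative.OneSided
import Summits.SmoothPoincare4.SmoothPoincare4.Theorems.AcyclicBisectionExists.Negative.TwistedDoubles
import Literature.Topology.FourManifolds.Gluing
import Literature.Geometry.Symplectic.PlanarContactBoundary

/-!
# Stub `stub_glueWitness` of line `modp-braid-orbits` (reshape r4) for crux
`ConvexBisection.AcyclicBisectionExists` (item stmt-SmoothPoincare4-10508, route route-SmoothPoincare4-ConvexBisection)

TWISTED-GLUE DATA GIVE THE CRUX'S ∃-BODY.  Over a homotopy 4-sphere `M ≃ₕ S⁴`: if `M = W₁ ∪_ψ W₂`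
is the boundary gluing (`Literature.Topology.FourManifolds.IsBoundaryGluing`) of two compact Stein
domains `(W₁, S₁)`, `(W₂, S₂)` along a diffeomorphism `ψ : ∂W₁ ≅ ∂W₂` of boundary data carrying
the `S₁`-induced boundary plane field (`Literature.Geometry.Symplectic.boundaryPlaneField`) onto the
complex tangencies `contactPlane S₂.J`, and `W₁` is connected and ℚ-acyclic in positive degrees,
then `M` carries a Stein bisection along a common contact seam with both halves ℚ-acyclic
(`Negative.HasAcyclicSteinBisection M`, the ∃-body of the crux as a predicate).

This is the registered stub `stub_glueWitness` of the checked skeleton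
`Cruxes/AcyclicBisectionExists/Lines/modp-braid-orbits.lean` (lead reshape r4): the packaging step
between the geometric dictionary's output (Baykur's split `M = X₊ ∪ X₋` recorded as twisted-glue
data) and the crux.  Proof: the disprover's landed `Negative.Witness.ofTwistedGlue` (the glued pieces
are a witness: embeddings, cover, seam = images of the boundaries, pushed-forward planes equal by
the chain rule, `Negative/TwistedDoubles.lean`) and the landed one-sided duality
`Negative.Witness.acyclicRight_of_acyclicLeft_of_homotopyEquiv'` (`Negative/OneSided.lean`).
-/

noncomputable section

-- the prescribed namespace `Summit.<P>.<Sub>.…` duplicates `SmoothPoincare4` (P = Sub)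
set_option linter.dupNamespace false

open scoped Manifold ContDiff Topology ContinuousMap

namespace Summit.SmoothPoincare4.SmoothPoincare4.Theorems.AcyclicBisectionExists.ModpBraidOrbits

open Summit.SmoothPoincare4.SmoothPoincare4.Theorems.AcyclicBisectionExists.Negative
open Literature.Topology.FourManifolds (BoundaryData IsBoundaryGluing)
open Literature.Geometry.Symplectic (SteinStructure contactPlane boundaryPlaneField)
open Literature.AlgebraicTopology.SingularHomology (singularHomology)

/-- **Stub `stub_glueWitness` (twisted-glue data give the crux's ∃-body).** Over `M ≃ₕ S⁴`: if
`M = W₁ ∪_ψ W₂` is the boundary gluing of two compact Stein domains `(W₁, S₁)`, `(W₂, S₂)` along a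
diffeomorphism `ψ : ∂W₁ ≅ ∂W₂` carrying the `S₁`-induced boundary plane field onto the complex
tangencies of `S₂`, and `W₁` is connected and ℚ-acyclic in positive degrees, then
`HasAcyclicSteinBisection M`: the glued pieces form a witness (`Negative.Witness.ofTwistedGlue`) whose
second half is ℚ-acyclic by one-sided duality over the homotopy sphere
(`Negative.Witness.acyclicRight_of_acyclicLeft_of_homotopyEquiv'`). [folklore] -/
theorem stub_glueWitness :
    ∀ (M : Type) [TopologicalSpace M] [T2Space M] [SecondCountableTopology M]
      [ChartedSpace (EuclideanSpace ℝ (Fin 4)) M] [IsManifold (𝓡 4) ∞ M],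
      M ≃ₕ Metric.sphere (0 : EuclideanSpace ℝ (Fin 5)) 1 →
      ∀ (W₁ : Type) [TopologicalSpace W₁] [ChartedSpace (EuclideanHalfSpace 4) W₁]
        [IsManifold (𝓡∂ 4) ∞ W₁] [CompactSpace W₁]
        (W₂ : Type) [TopologicalSpace W₂] [ChartedSpace (EuclideanHalfSpace 4) W₂]
        [IsManifold (𝓡∂ 4) ∞ W₂] [CompactSpace W₂]
        (S₁ : SteinStructure W₁) (S₂ : SteinStructure W₂)
        (b₁ : BoundaryData (𝓡∂ 4) W₁ (𝓡 3)) (b₂ : BoundaryData (𝓡∂ 4) W₂ (𝓡 3))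
        (ψ : b₁.carrier ≃ₘ⟮𝓡 3, 𝓡 3⟯ b₂.carrier),
        (∀ z, Submodule.map (mfderiv (𝓡 3) (𝓡∂ 4) (b₂.incl ∘ ψ) z).toLinearMap
            (boundaryPlaneField S₁.J b₁ z) = contactPlane S₂.J (b₂.incl (ψ z))) →
        IsBoundaryGluing b₁ b₂ ψ (𝓡 4) M →
        ConnectedSpace W₁ →
        (∀ k, 0 < k → CategoryTheory.Limits.IsZero (singularHomology ℚ ℚ W₁ k)) →
        HasAcyclicSteinBisection M := by
  intro M _ _ _ _ _ e W₁ _ _ _ _ W₂ _ _ _ _ S₁ S₂ b₁ b₂ ψ hψ hglue hconn hac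
  let B : Witness M := Witness.ofTwistedGlue b₁ b₂ S₁ S₂ ψ hψ hglue
  haveI : Nonempty M := ⟨e.invFun ⟨EuclideanSpace.single 0 1, by simp⟩⟩
  haveI : ConnectedSpace B.W₁ := hconn
  have hleft : B.AcyclicLeft := hac
  exact ⟨B, (B.acyclic_iff).2 ⟨hleft, B.acyclicRight_of_acyclicLeft_of_homotopyEquiv' e hleft⟩⟩

end Summit.SmoothPoincare4.SmoothPoincare4.Theorems.AcyclicBisectionExists.ModpBraidOrbits

end
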